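import Mathlib
import Summits.Ventures.HodgeRepro2.Tier7.Line3.KappaDataArch

/-!
# Tier 7 — LINE 3 support: the representing pair WITH its defining clauses (the archimedean factor is pinned to `γ`)
(`Line3/KappaDataArchRep.lean`; t7-L1-p5, gen 2; closes t7-crit-2's OBJECTION (F), STATUS l. 15447)

`KappaDataArch.exists_archFactor_decay_of_sig11` states only the DECAY of the model's two-torus orbital integral at a
representing pair `rep γ` — the clauses tying `rep γ` to `γ` (`mat γ′ = P (c • ψ(matO γ)) Q` with `|c| = 1`, the fixed
`h`, the equality of the invariants), which its proof has, are dropped at the statement; so a `Classical.choose` on it is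
an uncontrolled pair (crit-2 (F)). This file states the pair WITH its clauses:
* `Sig11Data.exists_SU11_rep`: for an isometry `γ` of the adapted `(1,1)`-form with `det γ = 1` there are `γ′, h ∈ SU(1,1)`
  with `mat γ′ = P γ Q`, **`mat h = phasedColMatrix r s f`** (the normalised, phase-corrected second basis — the SAME `h` for
  every `γ`) and `kappa conj dd (colBasis h) (mat γ′) = kappa conj r f γ` (KappaArchimedean's construction, `h` exposed);
* `Sig11Data.exists_SU11_rep'`: the same for EVERY isometry, with a phase `c`, `|c| = 1`, `mat γ′ = P (c • γ) Q`;
* **`exists_archFactor_decay_of_sig11_rep`**: `∃ rep : Orb → SU11 × SU11, ∀ γ, (∃ c, |c|² = 1 ∧ mat (rep γ).1 =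
  P r (c • (matO γ).map ψ) Q r) ∧ mat (rep γ).2 = phasedColMatrix r s (ψ ∘∘ f) ∧ kappa conj dd (colBasis (rep γ).2)
  (mat (rep γ).1) = kappa conj r (ψ ∘∘ f) ((matO γ).map ψ) ∧ ∀ k ≥ 2, ∀ j n p q, ‖∫∫ … (rep γ)‖ ≤ decayConst k j n ·
  monomialNormSq k n · reAt hw (κF γ) ^ (−k/2)` — the pair is the conjugate of `ψ (matO γ)` by an explicit unit phase and
  the fixed `h`, and p1's row-677 decay holds at THAT pair.
What stays in words: as in `KappaDataArch` (the §0 signature data; that the model integral at `rep γ` is the real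
archimedean factor — U1 / U3). Nothing about periods or (N).
Sorry-free; axioms: propext / Classical.choice / Quot.sound. §8(d): uses an L-value-free non-vanishing device: NO.
-/

namespace Summit.Ventures.HodgeRepro2.Tier7.Line3.KappaDataArchRep

open NumberField Matrix MeasureTheory Summit.Ventures.HodgeRepro2.T7SupportTwoTorusInvariant
  Summit.Ventures.HodgeRepro2.Tier7.Line3.KappaNatural Summit.Ventures.HodgeRepro2.Tier7.Line3.KappaArchimedean
  Summit.Ventures.HodgeRepro2.Tier7.Line3.KappaPlaces Summit.Ventures.HodgeRepro2.Tier7.Line3.KappaDecay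
  Summit.Ventures.HodgeRepro2.Tier7.Line3.KappaDataArch Summit.Ventures.HodgeRepro2.Tier7.Line3.DominantSideOfKappa
open Summit.Ventures.HodgeRepro2.T7SupportKappaCartan (dd colBasis)
open Summit.Ventures.HodgeRepro2.T5UnitaryBound (MemU11)
open Summit.Ventures.HodgeRepro2.T5SU11Unimodular (SU11)
open Summit.Ventures.HodgeRepro2.T5BergmanCoefficient (mat act)
open Summit.Ventures.HodgeRepro2.T5SU11Fibration (rot)
open Summit.Ventures.HodgeRepro2.T5BergmanMatrixCoeff (matrixCoeff)
open Summit.Ventures.HodgeRepro2.T5HaarCircle (haarCircle)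
open Summit.Ventures.HodgeRepro2.T5BergmanKTypeMatrix (decayConst)
open Summit.Ventures.HodgeRepro2.T5BergmanParseval (monomialNormSq)

/-! ## 1. The representing pair with `h` exposed -/

/-- **the representing pair, `det γ = 1`**: `γ′ = P γ Q`, `h = phasedColMatrix r s f`, and the model invariant of
`(γ′, h)` is the adapted invariant of `γ` -/
theorem Sig11Data.exists_SU11_rep {r s : Fin 2 → ℝ} {f : Fin 2 → Fin 2 → ℂ} (D : Sig11Data r s f)
    {γ : Matrix (Fin 2) (Fin 2) ℂ} (hγ : IsIsom (starRingEnd ℂ) (fun i => (r i : ℂ)) γ) (hdet : γ.det = 1) :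
    ∃ γ' h : SU11, mat γ' = P r * γ * Q r ∧ mat h = phasedColMatrix r s f ∧
      kappa (starRingEnd ℂ) dd (colBasis h) (mat γ') = kappa (starRingEnd ℂ) (fun i => (r i : ℂ)) f γ := by
  have hdet' : (P r * γ * Q r).det = 1 := by rw [det_conj D.hr, hdet]
  let γ' : SU11 := ⟨⟨P r * γ * Q r, hdet'⟩, (T5SU11Unimodular.mem_SU11_iff _).2 (D.memU11_conj hγ)⟩
  let h : SU11 := ⟨⟨phasedColMatrix r s f, D.det_phasedColMatrix⟩,
    (T5SU11Unimodular.mem_SU11_iff _).2 D.memU11_phasedColMatrix⟩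
  have hmat : mat γ' = P r * γ * Q r := rfl
  have hmath : mat h = phasedColMatrix r s f := rfl
  have hcol : colBasis h =
      fun j => (![1, (starRingEnd ℂ) (colMatrix (nf r s f)).det] : Fin 2 → ℂ) j • nf r s f j := by
    funext j i
    show phasedColMatrix r s f i j = _
    unfold phasedColMatrix
    rw [mul_diagonal]
    simp only [colMatrix, Matrix.of_apply, Pi.smul_apply, smul_eq_mul]
    ring
  refine ⟨γ', h, hmat, hmath, ?_⟩
  rw [hcol, hmat, kappa_smul_second (starRingEnd ℂ) conj_conj' dd (nf r s f) _ one_ne_zero,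
    kappa_eq_kappa_sgn D.hr, sgn_eq_dd D.hr0 D.hr1]
  have key := kappa_smul_second (starRingEnd ℂ) conj_conj' dd (fun j => P r *ᵥ f j)
    (fun j => (sq s j)⁻¹) (inv_ne_zero (sq_ne_zero_of_ne D.hs0.ne')) (P r * γ * Q r)
  rw [← key]
  rfl

/-- **the representing pair, every isometry**: a phase `c` with `|c|² = 1`, `γ′ = P (c • γ) Q`, `h = phasedColMatrix r s f` -/
theorem Sig11Data.exists_SU11_rep' {r s : Fin 2 → ℝ} {f : Fin 2 → Fin 2 → ℂ} (D : Sig11Data r s f)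
    {γ : Matrix (Fin 2) (Fin 2) ℂ} (hγ : IsIsom (starRingEnd ℂ) (fun i => (r i : ℂ)) γ) :
    ∃ c : ℂ, Complex.normSq c = 1 ∧ ∃ γ' h : SU11, mat γ' = P r * (c • γ) * Q r ∧
      mat h = phasedColMatrix r s f ∧
      kappa (starRingEnd ℂ) dd (colBasis h) (mat γ') = kappa (starRingEnd ℂ) (fun i => (r i : ℂ)) f γ := by
  have hu : (Complex.normSq γ.det : ℂ) = 1 := by
    have := normSq_det_of_memU11 (D.memU11_conj hγ)
    rw [det_conj D.hr] at this
    exact this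
  have hu' : Complex.normSq γ.det = 1 := by exact_mod_cast hu
  have hu0 : γ.det ≠ 0 := by
    intro h; rw [h, map_zero] at hu'; exact zero_ne_one hu'
  obtain ⟨c, hc⟩ := IsAlgClosed.exists_pow_nat_eq (γ.det)⁻¹ (by norm_num : 0 < 2)
  have hc1 : Complex.normSq c = 1 := by
    have h1 : Complex.normSq c ^ 2 = 1 := by
      rw [← map_pow, hc, Complex.normSq_inv, hu', inv_one]
    have h0 : 0 ≤ Complex.normSq c := Complex.normSq_nonneg c
    nlinarith [sq_nonneg (Complex.normSq c - 1), sq_nonneg (Complex.normSq c + 1)]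
  have hnrm : nrm (starRingEnd ℂ) c = 1 := by
    rw [Tier7.Line3.KappaDefiniteBound.nrm_conjC, hc1]; simp
  have hdet : (c • γ).det = 1 := by
    rw [det_smul, Fintype.card_fin, hc, inv_mul_cancel₀ hu0]
  obtain ⟨γ', h, hmat, hmath, hk⟩ := Sig11Data.exists_SU11_rep D (isIsom_smul (starRingEnd ℂ) _ hnrm hγ) hdet
  refine ⟨c, hc1, γ', h, hmat, hmath, ?_⟩
  rw [hk, kappa_smul_mat, hnrm, one_mul]

/-! ## 2. The archimedean factor pinned to `γ` -/

variable {E K : Type*} [Field E] [Field K] [Algebra K E] (σ : E →+* E) (ψ : E →+* ℂ)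
  (d : Fin 2 → E) (f : Fin 2 → Fin 2 → E) {Orb : Type*} (matO : Orb → Matrix (Fin 2) (Fin 2) E) (κF : Orb → K)
  {w : InfinitePlace K} (hw : w.IsReal)

/-- **the fields `ha₂` / `ha₃` WITH the representing clauses**: `rep γ = (γ′, h)` with `γ′` the conjugate of
`ψ (matO γ)` by an explicit unit phase, `h` the fixed phased normalised basis, the invariants equal, and p1's
row-677 decay at THAT pair in the real value of the global invariant -/
theorem exists_archFactor_decay_of_sig11_rep [MeasurableSpace Circle] [BorelSpace Circle]
    (hψ : ∀ x, ψ (σ x) = (starRingEnd ℂ) (ψ x)) (hφ : ∀ x, ψ (algebraMap K E x) = w.embedding x)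
    {r s : Fin 2 → ℝ} (hdr : ∀ i, ψ (d i) = (r i : ℂ)) (D : Sig11Data r s (fun j i => ψ (f j i)))
    (hiso : ∀ γ, IsIsom σ d (matO γ)) (hκ : ∀ γ, algebraMap K E (κF γ) = kappa σ d f (matO γ)) :
    ∃ rep : Orb → SU11 × SU11, ∀ γ : Orb,
      (∃ c : ℂ, Complex.normSq c = 1 ∧ mat (rep γ).1 = P r * (c • (matO γ).map ψ) * Q r) ∧
      mat (rep γ).2 = phasedColMatrix r s (fun j i => ψ (f j i)) ∧
      kappa (starRingEnd ℂ) dd (colBasis (rep γ).2) (mat (rep γ).1) =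
        kappa (starRingEnd ℂ) (fun i => (r i : ℂ)) (fun j i => ψ (f j i)) ((matO γ).map ψ) ∧
      ∀ (k j n : ℕ), 2 ≤ k → ∀ (p q : ℤ),
        ‖∫ u : Circle, ∫ v : Circle,
            matrixCoeff k (act k (rep γ).2 (fun w => w ^ j)) (fun w => w ^ n)
              (rot u * (rep γ).1 * ((rep γ).2 * rot v * (rep γ).2⁻¹)) *
              ((u : ℂ) ^ p * (starRingEnd ℂ) ((v : ℂ) ^ q)) ∂haarCircle ∂haarCircle‖ ≤
          decayConst k j n * monomialNormSq k n * reAt hw (κF γ) ^ (-(k : ℝ) / 2) := by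
  have hd : (fun i => ψ (d i)) = fun i => (r i : ℂ) := funext hdr
  have hisoC : ∀ γ, IsIsom (starRingEnd ℂ) (fun i => (r i : ℂ)) ((matO γ).map ψ) := by
    intro γ
    have := isIsom_map σ (starRingEnd ℂ) ψ hψ d (hiso γ)
    rwa [hd] at this
  have hex : ∀ γ, ∃ c : ℂ, Complex.normSq c = 1 ∧ ∃ γ' h : SU11,
      mat γ' = P r * (c • (matO γ).map ψ) * Q r ∧ mat h = phasedColMatrix r s (fun j i => ψ (f j i)) ∧
      kappa (starRingEnd ℂ) dd (colBasis h) (mat γ') =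
        kappa (starRingEnd ℂ) (fun i => (r i : ℂ)) (fun j i => ψ (f j i)) ((matO γ).map ψ) :=
    fun γ => Sig11Data.exists_SU11_rep' D (hisoC γ)
  choose c hc γ' h hmat hmath hk using hex
  refine ⟨fun γ => (γ' γ, h γ), fun γ => ⟨⟨c γ, hc γ, hmat γ⟩, hmath γ, hk γ, fun k j n hk2 p q => ?_⟩⟩
  have hre : (kappa (starRingEnd ℂ) (fun i => (r i : ℂ)) (fun j i => ψ (f j i)) ((matO γ).map ψ)).re =
      reAt hw (κF γ) := by
    rw [← re_map_kappa_eq σ ψ d f matO κF hw hφ hκ γ, kappa_map σ (starRingEnd ℂ) ψ hψ d f (matO γ), hd]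
  have := Summit.Ventures.HodgeRepro2.T7SupportBergmanOrbitalDecay.norm_torus_orbital_conj_le_kappa k j n hk2
    (h γ) (γ' γ) p q
  rw [hk γ, hre] at this
  exact this

/-- **the phase as a function** (t7-crit-2 l. 15470 record (c)): the same statement with the unit phase `c γ` exposed
as a function of `γ`, so that a central-character factor `ω (c γ)⁻¹` can be displayed as a clause -/
theorem exists_archFactor_decay_of_sig11_rep_phase [MeasurableSpace Circle] [BorelSpace Circle]
    (hψ : ∀ x, ψ (σ x) = (starRingEnd ℂ) (ψ x)) (hφ : ∀ x, ψ (algebraMap K E x) = w.embedding x)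
    {r s : Fin 2 → ℝ} (hdr : ∀ i, ψ (d i) = (r i : ℂ)) (D : Sig11Data r s (fun j i => ψ (f j i)))
    (hiso : ∀ γ, IsIsom σ d (matO γ)) (hκ : ∀ γ, algebraMap K E (κF γ) = kappa σ d f (matO γ)) :
    ∃ (rep : Orb → SU11 × SU11) (c : Orb → ℂ), ∀ γ : Orb,
      Complex.normSq (c γ) = 1 ∧ mat (rep γ).1 = P r * (c γ • (matO γ).map ψ) * Q r ∧
      mat (rep γ).2 = phasedColMatrix r s (fun j i => ψ (f j i)) ∧
      kappa (starRingEnd ℂ) dd (colBasis (rep γ).2) (mat (rep γ).1) =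
        kappa (starRingEnd ℂ) (fun i => (r i : ℂ)) (fun j i => ψ (f j i)) ((matO γ).map ψ) ∧
      ∀ (k j n : ℕ), 2 ≤ k → ∀ (p q : ℤ),
        ‖∫ u : Circle, ∫ v : Circle,
            matrixCoeff k (act k (rep γ).2 (fun w => w ^ j)) (fun w => w ^ n)
              (rot u * (rep γ).1 * ((rep γ).2 * rot v * (rep γ).2⁻¹)) *
              ((u : ℂ) ^ p * (starRingEnd ℂ) ((v : ℂ) ^ q)) ∂haarCircle ∂haarCircle‖ ≤
          decayConst k j n * monomialNormSq k n * reAt hw (κF γ) ^ (-(k : ℝ) / 2) := by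
  obtain ⟨rep, hrep⟩ := exists_archFactor_decay_of_sig11_rep σ ψ d f matO κF hw hψ hφ hdr D hiso hκ
  choose c hc using fun γ => (hrep γ).1
  exact ⟨rep, c, fun γ => ⟨(hc γ).1, (hc γ).2, (hrep γ).2.1, (hrep γ).2.2.1, (hrep γ).2.2.2⟩⟩

end Summit.Ventures.HodgeRepro2.Tier7.Line3.KappaDataArchRep
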